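import Summits.ResolutionOfSingularities.ResolutionOfSingularities.Theses.ShadowGame

/-!
# `ShadowGameWin` (crux stmt-ResolutionOfSingularities-16159, route `ShadowGame`), negative side —
# part 1: named mirror of the move generator, monomial calculus, and the data of B's trap

The route decl `ShadowGame.ShadowGameWin` inlines its move generator as a 2.1k-char `let`-block.
Here the SAME bodies are given names (`clean / bl / mF / dv / tr / step / shadow / play`), so that
the route decl is definitionally equal to the statement written with these names (used via a
`have … := h` in `Theorems/ShadowGameShadowGameWinRefutation.lean`).  The moves `clean`, `bl`,
`dv`, `tr` are linear; for `n = 2` their action on a monomial `mono (a, b) v = v·uᵃvᵇ` is computed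
in closed form, which turns every move into an operation on LISTS of monomials (`fsum L`),
decidable over a finite field (the translation move is in part 2).  The file also holds all the
DATA of the refutation at `(p, n) = (3, 2)` over `𝔽₃`: the six states `S0 … S5` of B's trap
(`cycle`), B's policy (`chart`: the chart `u` whenever allowed; `tau`: translate `v` by `1` at
`S2`, by `2` at `S5`, else by `0`) and B's simulation `run` of the play with the induced move
sequences `iSeq / tSeq`.  Part 2 (`Trap.lean`, theorems only) proves the six transitions and the
non-terminality; `Theorems/ShadowGameShadowGameWinRefutation.lean` assembles `¬ ShadowGameWin`.
Refuter seat refuter-rattack-stmt-ResolutionOfSingularities-16159-0, 2026-08-17.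
-/

noncomputable section

set_option linter.dupNamespace false

namespace Summit.ResolutionOfSingularities.ResolutionOfSingularities.Theorems.ShadowGameWin.Negative

section Mirror

variable {n : ℕ} {κ : Type} [Field κ] (p : ℕ)

/-! ## Mirror of the `let`-bound move generator of `ShadowGame.ShadowGameWin` (verbatim bodies) -/

/-- cleaning: delete monomials with exponent in `pℕ^n`. [folklore] -/
def clean (c : (Fin n → ℕ) → κ) : (Fin n → ℕ) → κ :=
  fun A => @ite κ (∀ j, p ∣ A j) (Classical.dec _) 0 (c A)

/-- blow-up of `V(u_j : j ∈ F)` in the chart `i`. [folklore] -/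
def bl (F : Finset (Fin n)) (i : Fin n) (c : (Fin n → ℕ) → κ) : (Fin n → ℕ) → κ :=
  fun B => @ite κ (Finset.sum (F.erase i) (fun j => B j) ≤ B i) (Classical.dec _)
    (c (Function.update B i (B i - Finset.sum (F.erase i) (fun j => B j)))) 0

/-- `F`-order of a series. [folklore] -/
def mF (F : Finset (Fin n)) (c : (Fin n → ℕ) → κ) : ℕ :=
  sInf {m : ℕ | ∃ A, c A ≠ 0 ∧ m = Finset.sum F (fun j => A j)}

/-- division by `u_i ^ s`. [folklore] -/
def dv (i : Fin n) (s : ℕ) (c : (Fin n → ℕ) → κ) : (Fin n → ℕ) → κ :=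
  fun B => c (Function.update B i (B i + s))

/-- translation `u_j ↦ u_j + τ_j` (`j ∈ F \ {i}`). [folklore] -/
def tr (F : Finset (Fin n)) (i : Fin n) (τ : Fin n → κ) (s : ℕ) (c : (Fin n → ℕ) → κ) :
    (Fin n → ℕ) → κ :=
  fun B => Finset.sum (Fintype.piFinset (fun _ : Fin n => Finset.range (B i + s + 1)))
    (fun D => @ite κ (∀ j, j ∉ F.erase i → D j = 0) (Classical.dec _)
      (c (B + D) * Finset.prod (F.erase i)
        (fun j => ((Nat.choose (B j + D j) (B j) : ℕ) : κ) * τ j ^ (D j))) 0)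

/-- one move of the game. [folklore] -/
def step (F : Finset (Fin n)) (i : Fin n) (τ : Fin n → κ) (c : (Fin n → ℕ) → κ) :
    (Fin n → ℕ) → κ :=
  clean p (tr F i τ (p * (mF F (clean p c) / p))
    (dv i (p * (mF F (clean p c) / p)) (bl F i (clean p c))))

/-- the shadow (Newton polyhedron). [folklore] -/
def shadow (c : (Fin n → ℕ) → κ) : Set (Fin n → ℚ) :=
  convexHull ℚ {x : Fin n → ℚ | ∃ A, clean p c A ≠ 0 ∧ ∀ j, ((A j : ℚ) / p) ≤ x j}

/-- the play. [folklore] -/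
def play (strat : List (Set (Fin n → ℚ)) → List (Fin n) → Finset (Fin n)) (c₀ : (Fin n → ℕ) → κ)
    (i : ℕ → Fin n) (t : ℕ → Fin n → κ) :
    ℕ → (((Fin n → ℕ) → κ) × List (Set (Fin n → ℚ)) × List (Fin n)) :=
  fun m => @Nat.rec (fun _ => ((Fin n → ℕ) → κ) × List (Set (Fin n → ℚ)) × List (Fin n))
    (c₀, [shadow p c₀], ([] : List (Fin n)))
    (fun m st => (step p (strat st.2.1 st.2.2) (i m) (t m) st.1,
      st.2.1 ++ [shadow p (step p (strat st.2.1 st.2.2) (i m) (t m) st.1)], st.2.2 ++ [i m])) m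

/-- One step of `play` (iota-reduction of the `Nat.rec`). [folklore] -/
theorem play_succ (strat : List (Set (Fin n → ℚ)) → List (Fin n) → Finset (Fin n))
    (c₀ : (Fin n → ℕ) → κ) (i : ℕ → Fin n) (t : ℕ → Fin n → κ) (m : ℕ) :
    play p strat c₀ i t (m + 1) =
      (step p (strat (play p strat c₀ i t m).2.1 (play p strat c₀ i t m).2.2) (i m) (t m)
          (play p strat c₀ i t m).1,
        (play p strat c₀ i t m).2.1 ++ [shadow p (step p (strat (play p strat c₀ i t m).2.1
          (play p strat c₀ i t m).2.2) (i m) (t m) (play p strat c₀ i t m).1)],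
        (play p strat c₀ i t m).2.2 ++ [i m]) := rfl

/-! ## Linearity of the moves -/

/-- `clean` is linear: zero. [folklore] -/
theorem clean_zero : clean p (0 : (Fin n → ℕ) → κ) = 0 := by
  funext A; unfold clean; split_ifs <;> rfl

/-- `clean` is linear: additivity. [folklore] -/
theorem clean_add (f g : (Fin n → ℕ) → κ) : clean p (f + g) = clean p f + clean p g := by
  funext A; unfold clean; simp only [Pi.add_apply]; split_ifs <;> simp

/-- `bl` is linear: zero. [folklore] -/
theorem bl_zero (F : Finset (Fin n)) (i : Fin n) : bl F i (0 : (Fin n → ℕ) → κ) = 0 := by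
  funext B; unfold bl; split_ifs <;> rfl

/-- `bl` is linear: additivity. [folklore] -/
theorem bl_add (F : Finset (Fin n)) (i : Fin n) (f g : (Fin n → ℕ) → κ) :
    bl F i (f + g) = bl F i f + bl F i g := by
  funext B; unfold bl; simp only [Pi.add_apply]; split_ifs <;> simp

/-- `dv` is linear: additivity. [folklore] -/
theorem dv_add (i : Fin n) (s : ℕ) (f g : (Fin n → ℕ) → κ) :
    dv i s (f + g) = dv i s f + dv i s g := rfl

/-- `tr` is linear: zero. [folklore] -/
theorem tr_zero (F : Finset (Fin n)) (i : Fin n) (τ : Fin n → κ) (s : ℕ) :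
    tr F i τ s (0 : (Fin n → ℕ) → κ) = 0 := by
  funext B; unfold tr
  refine Finset.sum_eq_zero fun D _ => ?_
  split_ifs <;> simp

/-- `tr` is linear: additivity. [folklore] -/
theorem tr_add (F : Finset (Fin n)) (i : Fin n) (τ : Fin n → κ) (s : ℕ) (f g : (Fin n → ℕ) → κ) :
    tr F i τ s (f + g) = tr F i τ s f + tr F i τ s g := by
  funext B; unfold tr; simp only [Pi.add_apply]
  rw [← Finset.sum_add_distrib]
  refine Finset.sum_congr rfl fun D _ => ?_
  split_ifs <;> simp [add_mul]

/-! ## Moves with no translated coordinate -/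

/-- A centre with no translated coordinate (`F.erase i = ∅`) blows up nothing. [folklore] -/
theorem bl_self (F : Finset (Fin n)) (i : Fin n) (hF : F.erase i = ∅) (c : (Fin n → ℕ) → κ) :
    bl F i c = c := by
  funext B; unfold bl; rw [hF]; simp

omit [Field κ] in
/-- Division by `u_i ^ 0` is the identity. [folklore] -/
theorem dv_zero' (i : Fin n) (c : (Fin n → ℕ) → κ) : dv i 0 c = c := by
  funext B; unfold dv; simp

/-- With no translated coordinate the translation is the identity. [folklore] -/
theorem tr_self (F : Finset (Fin n)) (i : Fin n) (hF : F.erase i = ∅) (τ : Fin n → κ) (s : ℕ)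
    (c : (Fin n → ℕ) → κ) : tr F i τ s c = c := by
  funext B; unfold tr; rw [hF]
  rw [Finset.sum_eq_single (0 : Fin n → ℕ)]
  · simp
  · intro D _ hne
    have : ¬ ∀ j, j ∉ (∅ : Finset (Fin n)) → D j = 0 := fun h => hne (funext fun j => h j (by simp))
    rw [if_neg this]
  · intro h; exfalso; apply h
    simp [Fintype.mem_piFinset]

/-! ## Monomials and finite sums of monomials (n = 2) -/

/-- the monomial `v * u^e.1 v^e.2` as a coefficient function. [folklore] -/
def mono (e : ℕ × ℕ) (v : κ) : (Fin 2 → ℕ) → κ :=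
  fun B => if B 0 = e.1 ∧ B 1 = e.2 then v else 0

/-- finite sum of monomials. [folklore] -/
def fsum : List ((ℕ × ℕ) × κ) → (Fin 2 → ℕ) → κ
  | [] => 0
  | x :: L => mono x.1 x.2 + fsum L

/-- total coefficient of a key in a list. [folklore] -/
def fsumAt : List ((ℕ × ℕ) × κ) → ℕ × ℕ → κ
  | [] => fun _ => 0
  | x :: L => fun k => (if k = x.1 then x.2 else 0) + fsumAt L k

/-- Unfolding `fsumAt` on a cons. [folklore] -/
theorem fsumAt_cons (x : (ℕ × ℕ) × κ) (L : List ((ℕ × ℕ) × κ)) (k : ℕ × ℕ) :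
    fsumAt (x :: L) k = (if k = x.1 then x.2 else 0) + fsumAt L k := rfl

/-- Unfolding `fsum` on `[]`. [folklore] -/
theorem fsum_nil : fsum ([] : List ((ℕ × ℕ) × κ)) = 0 := rfl

/-- Unfolding `fsum` on a cons. [folklore] -/
theorem fsum_cons (x : (ℕ × ℕ) × κ) (L : List ((ℕ × ℕ) × κ)) :
    fsum (x :: L) = mono x.1 x.2 + fsum L := rfl

/-- `fsum` is additive under concatenation. [folklore] -/
theorem fsum_append (L L' : List ((ℕ × ℕ) × κ)) : fsum (L ++ L') = fsum L + fsum L' := by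
  induction L with
  | nil => simp [fsum_nil]
  | cons x L ih => rw [List.cons_append, fsum_cons, fsum_cons, ih, add_assoc]

/-- The coefficient of `u^B` in `fsum L` is the total coefficient of the key `(B 0, B 1)`.
[folklore] -/
theorem fsum_apply (L : List ((ℕ × ℕ) × κ)) (B : Fin 2 → ℕ) : fsum L B = fsumAt L (B 0, B 1) := by
  induction L with
  | nil => rfl
  | cons x L ih =>
    rw [fsum_cons, Pi.add_apply, ih, fsumAt_cons]
    unfold mono
    by_cases h : B 0 = x.1.1 ∧ B 1 = x.1.2
    · rw [if_pos h, if_pos (Prod.ext_iff.mpr h)]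
    · rw [if_neg h, if_neg (fun h' => h (Prod.ext_iff.mp h'))]

/-- Keys absent from the list have total coefficient `0`. [folklore] -/
theorem fsumAt_eq_zero (L : List ((ℕ × ℕ) × κ)) (k : ℕ × ℕ) (h : k ∉ L.map Prod.fst) :
    fsumAt L k = 0 := by
  induction L with
  | nil => rfl
  | cons x L ih =>
    rw [fsumAt_cons]
    rw [List.map_cons, List.mem_cons, not_or] at h
    rw [if_neg h.1, ih h.2, add_zero]

/-- The support of `fsum L` lies over the keys of `L`. [folklore] -/
theorem mem_keys_of_ne_zero (L : List ((ℕ × ℕ) × κ)) (B : Fin 2 → ℕ) (h : fsum L B ≠ 0) :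
    (B 0, B 1) ∈ L.map Prod.fst := by
  by_contra hk
  exact h (by rw [fsum_apply, fsumAt_eq_zero L _ hk])

/-- Two finite sums of monomials agree iff their total coefficients agree on the union of their
keys (a decidable check). [folklore] -/
theorem fsum_ext (L L' : List ((ℕ × ℕ) × κ))
    (h : ∀ k ∈ L.map Prod.fst ++ L'.map Prod.fst, fsumAt L k = fsumAt L' k) : fsum L = fsum L' := by
  funext B
  rw [fsum_apply, fsum_apply]
  by_cases hk : (B 0, B 1) ∈ L.map Prod.fst ++ L'.map Prod.fst
  · exact h _ hk
  · rw [List.mem_append, not_or] at hk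
    rw [fsumAt_eq_zero L _ hk.1, fsumAt_eq_zero L' _ hk.2]

/-! ## Cleaning, point blow-up (chart `u`) and division on monomials -/

/-- Cleaning a monomial. [folklore] -/
theorem clean_mono (e : ℕ × ℕ) (v : κ) :
    clean p (mono e v) = if p ∣ e.1 ∧ p ∣ e.2 then 0 else mono e v := by
  funext B
  unfold clean mono
  rw [Fin.forall_fin_two]
  by_cases h : B 0 = e.1 ∧ B 1 = e.2
  · rw [if_pos h, h.1, h.2]
    by_cases h' : p ∣ e.1 ∧ p ∣ e.2
    · rw [if_pos h', if_pos h']; rfl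
    · rw [if_neg h', if_neg h', if_pos h]
  · rw [if_neg h]
    by_cases h' : p ∣ e.1 ∧ p ∣ e.2
    · rw [if_pos h']; split_ifs <;> rfl
    · rw [if_neg h', if_neg h]; split_ifs <;> rfl

/-- Cleaning a finite sum of monomials = filtering the list. [folklore] -/
theorem clean_fsum (L : List ((ℕ × ℕ) × κ)) :
    clean p (fsum L) = fsum (L.filter fun x => decide ¬ (p ∣ x.1.1 ∧ p ∣ x.1.2)) := by
  induction L with
  | nil => rw [fsum_nil, clean_zero]; rfl
  | cons x L ih =>
    rw [fsum_cons, clean_add, clean_mono, ih, List.filter_cons]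
    by_cases h : p ∣ x.1.1 ∧ p ∣ x.1.2
    · rw [if_pos h]; simp [h]
    · rw [if_neg h]; simp [h, fsum_cons]

/-- `{u, v}` minus `u` is `{v}`. [folklore] -/
theorem erase_pair : (({0, 1} : Finset (Fin 2)).erase 0) = {1} := by decide

/-- Point blow-up, chart `u`, on a monomial: `u^a v^b ↦ u^(a+b) v^b`. [folklore] -/
theorem bl_pair_mono (e : ℕ × ℕ) (v : κ) :
    bl ({0, 1} : Finset (Fin 2)) 0 (mono e v) = mono (e.1 + e.2, e.2) v := by
  funext B
  unfold bl mono
  rw [erase_pair, Finset.sum_singleton]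
  simp only [Function.update_apply, if_true, one_ne_zero, if_false]
  split_ifs <;> first | rfl | (exfalso; omega)

/-- Point blow-up, chart `u`, on a finite sum of monomials. [folklore] -/
theorem bl_pair_fsum (L : List ((ℕ × ℕ) × κ)) :
    bl ({0, 1} : Finset (Fin 2)) 0 (fsum L) =
      fsum (L.map fun x => ((x.1.1 + x.1.2, x.1.2), x.2)) := by
  induction L with
  | nil => rw [fsum_nil, bl_zero]; rfl
  | cons x L ih => rw [fsum_cons, bl_add, bl_pair_mono, ih, List.map_cons, fsum_cons]

/-- Division by `u ^ s` on a monomial. [folklore] -/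
theorem dv0_mono (s : ℕ) (e : ℕ × ℕ) (v : κ) :
    dv 0 s (mono e v) = if s ≤ e.1 then mono (e.1 - s, e.2) v else 0 := by
  funext B
  unfold dv mono
  simp only [Function.update_apply, if_true, one_ne_zero, if_false]
  by_cases hs : s ≤ e.1
  · rw [if_pos hs]; split_ifs <;> first | rfl | (exfalso; omega)
  · rw [if_neg hs, Pi.zero_apply]; split_ifs <;> first | rfl | (exfalso; omega)

/-- Division by `u ^ s` on a finite sum of monomials. [folklore] -/
theorem dv0_fsum (s : ℕ) (L : List ((ℕ × ℕ) × κ)) :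
    dv 0 s (fsum L) =
      fsum ((L.filter fun x => decide (s ≤ x.1.1)).map fun x => ((x.1.1 - s, x.1.2), x.2)) := by
  induction L with
  | nil => rfl
  | cons x L ih =>
    rw [fsum_cons, dv_add, dv0_mono, ih, List.filter_cons]
    by_cases h : s ≤ x.1.1
    · rw [if_pos h]; simp [h, fsum_cons]
    · rw [if_neg h]; simp [h]

end Mirror

/-! ## The witness: `p = 3`, `n = 2`, `κ = 𝔽₃` — the six states of the trap -/

/-- state 0 (the start series `v² + u³v + u³v²`). [folklore] -/
def L0 : List ((ℕ × ℕ) × ZMod 3) := [((0, 2), 1), ((3, 1), 1), ((3, 2), 1)]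

/-- state 1. [folklore] -/
def L1 : List ((ℕ × ℕ) × ZMod 3) := [((2, 2), 1), ((4, 1), 1), ((5, 2), 1)]

/-- state 2. [folklore] -/
def L2 : List ((ℕ × ℕ) × ZMod 3) := [((1, 2), 1), ((2, 1), 1), ((4, 2), 1)]

/-- state 3. [folklore] -/
def L3 : List ((ℕ × ℕ) × ZMod 3) := [((0, 2), 1), ((3, 1), 2), ((3, 2), 1)]

/-- state 4. [folklore] -/
def L4 : List ((ℕ × ℕ) × ZMod 3) := [((2, 2), 1), ((4, 1), 2), ((5, 2), 1)]

/-- state 5. [folklore] -/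
def L5 : List ((ℕ × ℕ) × ZMod 3) := [((1, 2), 1), ((2, 1), 2), ((4, 2), 1)]

/-- state 0 as a series. [folklore] -/
abbrev S0 : (Fin 2 → ℕ) → ZMod 3 := fsum L0

/-- state 1 as a series. [folklore] -/
abbrev S1 : (Fin 2 → ℕ) → ZMod 3 := fsum L1

/-- state 2 as a series. [folklore] -/
abbrev S2 : (Fin 2 → ℕ) → ZMod 3 := fsum L2

/-- state 3 as a series. [folklore] -/
abbrev S3 : (Fin 2 → ℕ) → ZMod 3 := fsum L3

/-- state 4 as a series. [folklore] -/
abbrev S4 : (Fin 2 → ℕ) → ZMod 3 := fsum L4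

/-- state 5 as a series. [folklore] -/
abbrev S5 : (Fin 2 → ℕ) → ZMod 3 := fsum L5

/-- B's trap: the six states. [folklore] -/
def cycle : List ((Fin 2 → ℕ) → ZMod 3) := [S0, S1, S2, S3, S4, S5]

/-- Membership in the trap, unfolded. [folklore] -/
theorem mem_cycle_iff (c : (Fin 2 → ℕ) → ZMod 3) :
    c ∈ cycle ↔ c = S0 ∨ c = S1 ∨ c = S2 ∨ c = S3 ∨ c = S4 ∨ c = S5 := by
  simp [cycle]

/-! ## B's policy and B's simulation of the play -/

/-- B's chart: `u` whenever allowed. [folklore] -/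
def chart (F : Finset (Fin 2)) : Fin 2 := if (0 : Fin 2) ∈ F then 0 else 1

open Classical in
/-- B's translation of `v` (read off the current series). [folklore] -/
def tau (c : (Fin 2 → ℕ) → ZMod 3) : Fin 2 → ZMod 3 :=
  if c = S2 then fun _ => 1 else if c = S5 then fun _ => 2 else fun _ => 0

/-- B's simulation of the play from `S0` against `strat`. [folklore] -/
def run (strat : List (Set (Fin 2 → ℚ)) → List (Fin 2) → Finset (Fin 2)) :
    ℕ → ((Fin 2 → ℕ) → ZMod 3) × List (Set (Fin 2 → ℚ)) × List (Fin 2)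
  | 0 => (S0, [shadow 3 S0], [])
  | m + 1 =>
    (step 3 (strat (run strat m).2.1 (run strat m).2.2)
        (chart (strat (run strat m).2.1 (run strat m).2.2)) (tau (run strat m).1) (run strat m).1,
      (run strat m).2.1 ++ [shadow 3 (step 3 (strat (run strat m).2.1 (run strat m).2.2)
        (chart (strat (run strat m).2.1 (run strat m).2.2)) (tau (run strat m).1) (run strat m).1)],
      (run strat m).2.2 ++ [chart (strat (run strat m).2.1 (run strat m).2.2)])

/-- B's chart sequence. [folklore] -/
def iSeq (strat : List (Set (Fin 2 → ℚ)) → List (Fin 2) → Finset (Fin 2)) (m : ℕ) : Fin 2 :=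
  chart (strat (run strat m).2.1 (run strat m).2.2)

/-- B's translation sequence. [folklore] -/
def tSeq (strat : List (Set (Fin 2 → ℚ)) → List (Fin 2) → Finset (Fin 2)) (m : ℕ) :
    Fin 2 → ZMod 3 :=
  tau (run strat m).1

end Summit.ResolutionOfSingularities.ResolutionOfSingularities.Theorems.ShadowGameWin.Negative

end
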